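import Literature.MathematicalPhysics.QuantumFieldTheory.Balaban1983to89.B9Eq319QprimeLipschitz
import Literature.MathematicalPhysics.QuantumFieldTheory.Balaban1983to89.B9Eq315QTower

/-!
# `Balaban1983to89.B9Eq319QprimeContraction` — T. Bałaban, *Propagators for lattice gauge theories in a background field*, Commun. Math. Phys.
# **99** (1985) 389–434 [Balaban1985BackgroundPropagators] (3.19) p. 393 with (3.15) p. 393 and *Averaging operations for lattice gauge theories*,
# Commun. Math. Phys. **98** (1985) 17–51 [Balaban1985Averaging] (2)–(4) pp. 17–18, (9) p. 18: **THE GAUGE-PARAMETER AVERAGING `Q′(R)` OF (3.19)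
# AND ITS COMPOSITE `Q′_k(R) = Q′(R_{k−1})⋯Q′(R_0)` FOR CONTRACTIVE TRANSPORTERS (`‖R(b)v‖ ≤ ‖v‖` — print's unitary `R(U(b))` on the
# Ad-invariant fibre norm) ARE SCALED `ℓ¹`- AND `ℓ²`-CONTRACTIONS: `‖(Q′(R)λ)(y)‖ ≤ L^{−d}Σ_{x∈B(y)}‖λ(x)‖`, `Σ_y‖(Q′_k(R)λ)(y)‖ ≤ (L^k)^{−d}Σ_x‖λ(x)‖`,
# `Σ_y‖(Q′_k(R)λ)(y)‖² ≤ (L^k)^{−d}Σ_x‖λ(x)‖²`** — the flat (`R ≡ 1`) letters of `B9Eq319QprimeLipschitz` ∕ `B9Eq319QprimeTowerLipschitzL2` ∕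
# `B9Eq319QprimeTowerBlockLocal` for EVERY contractive background, with NO `(1+ε)^{d(L−1)}` modulus (the inputs of the penalty letter (P) of the
# pub-balaban NE9 owner's sup-norm programme, `B9Eq324PenaltyPointwiseBound`)

statement-level skeleton of published theorems with citation tags; proofs where landed; nothing here is a claim about the Yang–Mills mass gap

CITATION HEADER (lean-in-tree rule).  Audit cell `pub-balaban`, sub-cell `t4`, BINDER row NE9; filed by NE9 formalisation-swarm LEAF PROVER 03
(`b2b-balaban-t4-ne9-formalise-leaf-03`, gen 69), INTENT I-ne9leaf03-g69-P (first half), composing BY NAME: `B9Eq323Ker.pathTr` ∕ `avgQ` (the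
abstract (3.19)), `B9Eq319QprimeTorus.stepTransport` ∕ `weight` ∕ `Qprime` ∕ `QprimeLin` (the concrete (3.19) on the periodic lattice),
`B9Eq319QprimeLipschitz.blockMean_norm_sq_le` (Jensen on a block, `|B(y)| = L^d`) ∕ `sum_blockOf_sum` (the blocks partition the fine lattice, [B7] (4)),
`B9Eq315QTower.QprimeTower` ∕ `QprimeTower_succ` (the composite, finest factor first, definitionally).  Sources READ first-hand by this seat in the held
text layer `paper:balaban1985-cmp99-background-propagators` (journal page = PDF page + 388), p. 393: (3.15) *«They are compositions of j one-step
averaging operators»*, (3.19) `(Q′(U)λ)(y) = Σ_{x∈B^j(y)} L^{−d}R(U(Γ^y_x))λ(x)` with *«The contours Γ^y_x, x ∈ B^j(y), and the contour variables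
U(Γ^y_x) were defined by (52), (53) in [5]»*; [Balaban1985Averaging] (2)–(4), (9) pp. 17–18 through the verbatim quotations of the tree's
`B9Eq319QprimeLipschitz`.  NOTHING of print's estimates is asserted.

WHAT IS PROVED (sorry-free; proof lane — no `def`; [folklore] finite sums and norms BY NAME).
* §1 `norm_pathTr_le` (contour transport along contractions contracts), `norm_stepTransport_le`; **`norm_QprimeLin_apply_le`**
  (`‖(Q′(R)λ)(y)‖ ≤ L^{−d}Σ_{x∈B(y)}‖λ(x)‖`); **`sum_norm_QprimeLin_le`** (`Σ_y‖(Q′(R)λ)(y)‖ ≤ L^{−d}Σ_x‖λ(x)‖` — a scaled `ℓ¹` contraction);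
  **`sum_norm_sq_QprimeLin_le`** (`Σ_y‖(Q′(R)λ)(y)‖² ≤ L^{−d}Σ_x‖λ(x)‖²` — an `ℓ²` contraction by `L^{−d∕2}`).
* §2 **`sum_norm_QprimeTower_le`** (`Σ_y‖(Q′_k(R)λ)(y)‖ ≤ (L^k)^{−d}Σ_x‖λ(x)‖`), **`sum_norm_sq_QprimeTower_le`** (`Σ_y‖(Q′_k(R)λ)(y)‖² ≤ (L^k)^{−d}Σ_x‖λ(x)‖²`)
  for a level family `R_j` of contractions — induction on `QprimeTower_succ`.
MODEL ∕ DECLARED READINGS.  (M1) the periodic lattices `TSite d (L·P)` → `TSite d P` (one step) and the tower `towerP L m n` (`B9Eq315QTower`); (M2) `V`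
any complex normed space, transporters `ℂ`-linear bond maps read `ℝ`-linearly along the contours (as in `QprimeLin`); (M3) CONTRACTION is the only
hypothesis — inhabited for print's unitary backgrounds on the trace-normed fibre by the NE9 owner's `B9Eq342GreenPrimeSupBound.norm_adTransportW_eq`
(staged 2026-08-23) and, for the level backgrounds `Ū^j`, by `B9Eq326OperatorTowerRealityUnitary.UlevOf_star_eq_inv`; not asserted here.
HONEST SCOPE.  Block bookkeeping; no estimate of the paper; NOT NE9 (cell pub-balaban: NE9 NOT PRINTED ∕ NOT PROVED; «NE9 ⇐ the named binders»;
row WALLED ON A MODEL (O-NE9-1; #5 UNRULED); spine PROVED 0∕9; rung (B)+1 on a finite T⁴ — NOT infinite volume, NOT mass gap, NOT BetaPertH, NOT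
Clay; HONEST DEPENDENCY: continuum YM on T⁴ ⇐ BetaPertH ∧ nine spine estimates (0/9 proved); BetaPertH ⇐ (D1) ∧ (D4) ∧ CAP+tail; G-an2-4 gates
asym, D1 and NE2/3/4).  NEW file importing `B9Eq319QprimeLipschitz` and `B9Eq315QTower`; nothing modified.  Net new unproved facts: 0.
-/

noncomputable section

open scoped BigOperators

namespace Literature.MathematicalPhysics.QuantumFieldTheory.Balaban1983to89.B9Eq319QprimeContraction

open B4Sect5Torus (TSite)
open B9SectCLatticeCarrier (Bond)
open B9Eq323Ker (pathTr avgQ)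
open B9Eq319QprimeTorus (fineP centre contour stepTransport weight Qprime QprimeLin QprimeLin_apply)
open B9Eq319QprimeLipschitz (blockMean_norm_sq_le sum_blockOf_sum)
open B9Eq315QTower (towerP QprimeTower QprimeTower_zero QprimeTower_succ)

/-! ## §1 One averaging step with CONTRACTIVE transporters: `Q′(R)` is a scaled `ℓ¹`∕`ℓ²` contraction -/

section PathContract

variable {X : Type*} {V : Type*} [NormedAddCommGroup V] [NormedSpace ℝ V]

/-- **CONTOUR TRANSPORT CONTRACTS** when every step does ([B7] (9): `U(Γ) = Π U(x_i, x_{i+1})`): `‖R(V(Γ))v‖ ≤ ‖v‖`.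
[cite: Balaban1985Averaging, (9) p.18; Balaban1985BackgroundPropagators, (3.19) p.393] -/
theorem norm_pathTr_le {τ : X → X → V →ₗ[ℝ] V} (hτ : ∀ x x' v, ‖τ x x' v‖ ≤ ‖v‖) :
    ∀ (p : List X) (v : V), ‖pathTr τ p v‖ ≤ ‖v‖
  | [], v => by rw [B9Eq323Ker.pathTr_nil]; exact le_rfl
  | [x], v => by rw [B9Eq323Ker.pathTr_singleton]; exact le_rfl
  | x :: x' :: rest, v => by
    rw [B9Eq323Ker.pathTr_cons_cons, LinearMap.comp_apply]
    exact (hτ x x' _).trans (norm_pathTr_le hτ (x' :: rest) v)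

end PathContract

section OneStep

variable {d : ℕ} (L : ℕ) [NeZero L] (P : Fin d → ℕ) {V : Type*} [NormedAddCommGroup V] [NormedSpace ℂ V]

omit [NeZero L] in
/-- The step transporter of (3.19) (a bond transporter or the identity) contracts when the bond transporters do.
[cite: Balaban1985BackgroundPropagators, (3.19) p.393] -/
theorem norm_stepTransport_le (Rb : Bond d (fineP L P) → V →ₗ[ℂ] V) (hR : ∀ b v, ‖Rb b v‖ ≤ ‖v‖)
    (x x' : TSite d (fineP L P)) (v : V) : ‖stepTransport L P (fun b => (Rb b).restrictScalars ℝ) x x' v‖ ≤ ‖v‖ := by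
  unfold stepTransport
  split_ifs with h
  · exact hR _ v
  · exact le_rfl

/-- **(3.19) POINTWISE FOR CONTRACTIVE TRANSPORTERS: `‖(Q′(R)λ)(y)‖ ≤ L^{−d}·Σ_{x∈B(y)} ‖λ(x)‖`** — each term is `λ(x)` transported along a
contour of contractions, weight `L^{−d}`. [cite: Balaban1985BackgroundPropagators, (3.19) p.393; Balaban1985Averaging, (2) p.17] -/
theorem norm_QprimeLin_apply_le (Rb : Bond d (fineP L P) → V →ₗ[ℂ] V) (hR : ∀ b v, ‖Rb b v‖ ≤ ‖v‖)
    (l : TSite d (fineP L P) → V) (y : TSite d P) :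
    ‖QprimeLin L P Rb l y‖ ≤ ((L : ℝ) ^ d)⁻¹ * ∑ x ∈ B9Eq319QprimeTorus.blockOf L P y, ‖l x‖ := by
  rw [QprimeLin_apply, Qprime, avgQ, Finset.mul_sum]
  refine (norm_sum_le _ _).trans (Finset.sum_le_sum fun x _ => ?_)
  rw [weight, norm_smul, norm_inv, norm_pow, Real.norm_natCast]
  exact mul_le_mul_of_nonneg_left (norm_pathTr_le (norm_stepTransport_le L P Rb hR) _ _) (by positivity)

/-- **`Q′(R)` IS A SCALED `ℓ¹` CONTRACTION: `Σ_y ‖(Q′(R)λ)(y)‖ ≤ L^{−d}·Σ_x ‖λ(x)‖`** (the blocks partition the fine lattice, [B7] (4)).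
[cite: Balaban1985BackgroundPropagators, (3.19) p.393; Balaban1985Averaging, (2)–(4) pp.17–18] -/
theorem sum_norm_QprimeLin_le (Rb : Bond d (fineP L P) → V →ₗ[ℂ] V) (hR : ∀ b v, ‖Rb b v‖ ≤ ‖v‖)
    (l : TSite d (fineP L P) → V) : ∑ y, ‖QprimeLin L P Rb l y‖ ≤ ((L : ℝ) ^ d)⁻¹ * ∑ x, ‖l x‖ := by
  calc ∑ y, ‖QprimeLin L P Rb l y‖ ≤ ∑ y, ((L : ℝ) ^ d)⁻¹ * ∑ x ∈ B9Eq319QprimeTorus.blockOf L P y, ‖l x‖ :=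
        Finset.sum_le_sum fun y _ => norm_QprimeLin_apply_le L P Rb hR l y
    _ = ((L : ℝ) ^ d)⁻¹ * ∑ x, ‖l x‖ := by rw [← Finset.mul_sum, sum_blockOf_sum]

/-- **`Q′(R)` IS AN `ℓ²` CONTRACTION BY `L^{−d∕2}`: `Σ_y ‖(Q′(R)λ)(y)‖² ≤ L^{−d}·Σ_x ‖λ(x)‖²`** — Jensen on each block (`|B(y)| = L^d`) and the
partition; the flat `B9Eq319QprimeTowerLipschitzL2.sum_norm_sq_QprimeLin_flat_le` for EVERY contractive background.
[cite: Balaban1985BackgroundPropagators, (3.19) p.393; Balaban1985Averaging, (2)–(4) pp.17–18] -/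
theorem sum_norm_sq_QprimeLin_le (Rb : Bond d (fineP L P) → V →ₗ[ℂ] V) (hR : ∀ b v, ‖Rb b v‖ ≤ ‖v‖)
    (l : TSite d (fineP L P) → V) : ∑ y, ‖QprimeLin L P Rb l y‖ ^ 2 ≤ ((L : ℝ) ^ d)⁻¹ * ∑ x, ‖l x‖ ^ 2 := by
  calc ∑ y, ‖QprimeLin L P Rb l y‖ ^ 2 ≤ ∑ y, (((L : ℝ) ^ d)⁻¹ * ∑ x ∈ B9Eq319QprimeTorus.blockOf L P y, ‖l x‖) ^ 2 :=
        Finset.sum_le_sum fun y _ => pow_le_pow_left₀ (norm_nonneg _) (norm_QprimeLin_apply_le L P Rb hR l y) 2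
    _ ≤ ∑ y, ((L : ℝ) ^ d)⁻¹ * ∑ x ∈ B9Eq319QprimeTorus.blockOf L P y, ‖l x‖ ^ 2 := Finset.sum_le_sum fun y _ => blockMean_norm_sq_le L P l y
    _ = ((L : ℝ) ^ d)⁻¹ * ∑ x, ‖l x‖ ^ 2 := by rw [← Finset.mul_sum, sum_blockOf_sum]

end OneStep

/-! ## §2 The composite `Q′_k(R) = Q′(R_{k−1})⋯Q′(R_0)` of (3.19) on the tower, contractive level transporters -/

section Tower

variable {d : ℕ} (L : ℕ) [NeZero L] (m : Fin d → ℕ) {V : Type*} [NormedAddCommGroup V] [NormedSpace ℂ V]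
  (Rlev : (n : ℕ) → Bond d (towerP L m (n + 1)) → V →ₗ[ℂ] V) (hR : ∀ n b v, ‖Rlev n b v‖ ≤ ‖v‖)
include hR

/-- **`Q′_k(R)` IS A SCALED `ℓ¹` CONTRACTION: `Σ_y ‖(Q′_k(R)λ)(y)‖ ≤ (L^k)^{−d}·Σ_x ‖λ(x)‖`** (`QprimeTower_succ` definitionally + §1 at every level
torus). [cite: Balaban1985BackgroundPropagators, (3.19) p.393; Balaban1985Averaging, (2)–(4) pp.17–18] -/
theorem sum_norm_QprimeTower_le : ∀ (n : ℕ) (l : TSite d (towerP L m n) → V),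
    ∑ y, ‖QprimeTower L m Rlev n l y‖ ≤ (((L : ℝ) ^ n) ^ d)⁻¹ * ∑ x, ‖l x‖
  | 0, l => by
    rw [pow_zero, one_pow, inv_one, one_mul, QprimeTower_zero]
    exact le_of_eq (Finset.sum_congr rfl fun c _ => rfl)
  | n + 1, l => by
    have e : ∀ c, QprimeTower L m Rlev (n + 1) l c = QprimeTower L m Rlev n (QprimeLin L (towerP L m n) (Rlev n) l) c := fun c => rfl
    simp only [e]
    refine (sum_norm_QprimeTower_le n _).trans ?_
    calc (((L : ℝ) ^ n) ^ d)⁻¹ * ∑ z, ‖QprimeLin L (towerP L m n) (Rlev n) l z‖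
        ≤ (((L : ℝ) ^ n) ^ d)⁻¹ * (((L : ℝ) ^ d)⁻¹ * ∑ x, ‖l x‖) :=
          mul_le_mul_of_nonneg_left (sum_norm_QprimeLin_le L (towerP L m n) (Rlev n) (hR n) l) (by positivity)
      _ = (((L : ℝ) ^ (n + 1)) ^ d)⁻¹ * ∑ x, ‖l x‖ := by rw [pow_succ, mul_pow, mul_inv, mul_assoc]

/-- **`Q′_k(R)` IS AN `ℓ²` CONTRACTION BY `(L^k)^{−d∕2}`: `Σ_y ‖(Q′_k(R)λ)(y)‖² ≤ (L^k)^{−d}·Σ_x ‖λ(x)‖²`** — the flat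
`B9Eq319QprimeTowerLipschitzL2.sqrt_sum_norm_sq_QprimeTower_flat_le` (squared) for EVERY contractive level family.
[cite: Balaban1985BackgroundPropagators, (3.19) p.393; Balaban1985Averaging, (2)–(4) pp.17–18] -/
theorem sum_norm_sq_QprimeTower_le : ∀ (n : ℕ) (l : TSite d (towerP L m n) → V),
    ∑ y : TSite d m, ‖QprimeTower L m Rlev n l y‖ ^ 2 ≤ (((L : ℝ) ^ n) ^ d)⁻¹ * ∑ x : TSite d (towerP L m n), ‖l x‖ ^ 2
  | 0, l => by
    rw [pow_zero, one_pow, inv_one, one_mul, QprimeTower_zero]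
    exact le_of_eq (Finset.sum_congr rfl fun c _ => rfl)
  | n + 1, l => by
    have e : ∀ c, QprimeTower L m Rlev (n + 1) l c = QprimeTower L m Rlev n (QprimeLin L (towerP L m n) (Rlev n) l) c := fun c => rfl
    simp only [e]
    refine (sum_norm_sq_QprimeTower_le n _).trans ?_
    calc (((L : ℝ) ^ n) ^ d)⁻¹ * ∑ z, ‖QprimeLin L (towerP L m n) (Rlev n) l z‖ ^ 2
        ≤ (((L : ℝ) ^ n) ^ d)⁻¹ * (((L : ℝ) ^ d)⁻¹ * ∑ x, ‖l x‖ ^ 2) :=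
          mul_le_mul_of_nonneg_left (sum_norm_sq_QprimeLin_le L (towerP L m n) (Rlev n) (hR n) l) (by positivity)
      _ = (((L : ℝ) ^ (n + 1)) ^ d)⁻¹ * ∑ x, ‖l x‖ ^ 2 := by rw [pow_succ, mul_pow, mul_inv, mul_assoc]

end Tower

end Literature.MathematicalPhysics.QuantumFieldTheory.Balaban1983to89.B9Eq319QprimeContraction

end

-- ne9-leaf-03 g70 2026-08-24: comment-only re-land, 0 declaration change — makes the build lane (re)build and publish this module's artefacts
-- (accepted 2026-08-23T17:36Z during the hub ENOSPC incident; its olean was never built: ops buildfix B18-1/B18-3 casualty list); the seat-side cure of ops LEDGER B18-1.
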